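import Literature.NumberTheory.Automorphic.NewformAdelisationHecke
import Literature.NumberTheory.Automorphic.NewformAdelisationCuspidal
import HarnessLib

/-!
# lang.S24: discharge of the adelisation statement `Gelbart1975_exists_adelicNewform`

Topic `NumberTheory/Automorphic`; companion of `Sweep1SymmetricPowerAdelic`, which vendored the
classical-analytic half of Gelbart's dictionary newform ↦ cuspidal automorphic representation
as the named fact `Literature.NumberTheory.Automorphic.Gelbart1975_exists_adelicNewform`
(Gelbart (1975), §3.A, (3.4), Prop. 3.1, p. 28 and §3.B, Lemma 3.7; Bump (1997), §3.6,
(6.3)–(6.4) and the proof of Thm. 3.6.1): the adelisation of a newform `f ∈ S_k(Γ₁(N))`,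
`k ≥ 2`, is a non-zero `K(N)`-fixed vector of `L²_cusp(GL₂(𝔸_ℚ) ⧸ A_G GL₂(ℚ), μ)` on which
`[K(N) diag(ϖ,1) K(N)]` and `[K(N) diag(ϖ,ϖ) K(N)]` act by `p^{1-k/2} a_p(f)` and `χ_f(p)` for
every `p ∤ N`.

This file proves it (`Gelbart1975_exists_adelicNewform_holds`), by the assembly
`Gelbart1975_exists_adelicNewform_of_adelicLift` of `NewformAdelisationLift` fed with the two
analytic statements about the *defined* lift `φ_f = adelicLift N k f`, both now proved:

* cuspidality, `adelicLift_constantTermVanishes_holds` (`NewformAdelisationCuspidal`; Gelbart,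
  Prop. 3.1 (vii));
* the Hecke eigenvalues, `adelicLift_heckeEigenvalues_holds` (`NewformAdelisationHecke`; Gelbart,
  Lemma 3.7; Bump, p. 342).

The layers below them are `NewformAdelisation` (the archimedean lift, strong approximation
`GL₂(𝔸_ℚ) = GL₂(ℚ)(GL₂(ℝ)⁺ × K₁(N))`), `NewformAdelisationLift` (`φ_f`, its descent to the
automorphic quotient, `K(N)`-invariance, `L²`), `NewformAdelisationHeckeLocal` /
`NewformAdelisationHeckeCosets` (the cosets of `K diag(p,1) K`, locally and adelically) and
`NewformAdelisationHeckeClassical` (Diamond–Shurman's `T_p` and `∑ⱼ f ∣ βⱼ⁻¹ = p^{2-k} a_p f`).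

Consequences recorded here, with the adelisation statement no longer a hypothesis: Gelbart's
dictionary `Gelbart1975_exists_isAutomorphicRepOf` (Thm. 5.19 (a); Bump, Thm. 3.6.1) follows from
the two trunk facts alone — existence of an automorphic measure on `GL₂(𝔸_ℚ) ⧸ A_G GL₂(ℚ)`
(`AdelicGroupData.exists_isAutomorphicMeasure_gl 2 ℚ`, Borel–Harish-Chandra) and discrete
decomposability of `L²_cusp` (`AutomorphicGLn.isDiscretelyDecomposable_cuspidal 2 ℚ μ`,
Gelfand–Graev–Piatetski-Shapiro) —, for a *given* automorphic `μ` with `L²_cusp(μ)` discretely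
decomposable every newform of weight `≥ 2` has a cuspidal automorphic representation
(`exists_isAutomorphicRepOf_of_isDiscretelyDecomposable`), and lang.S24
(`exists_cuspidal_symmetricPower`) follows from the two trunk facts and Newton–Thorne's Thm. A
(`exists_cuspidal_symmetricPower_of_newtonThorne2021`), to which it is then equivalent
(`exists_cuspidal_symmetricPower_iff_newtonThorne2021_of_isDiscretelyDecomposable`).

## References

* S. Gelbart, *Automorphic forms on adele groups*, Ann. of Math. Stud. 83 (1975): §3.A, (3.4),
  Prop. 3.1, p. 28; §3.B, (3.15), Lemma 3.7, pp. 31–32; §5.C, Thm. 5.19 [Gelbart1975].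
* D. Bump, *Automorphic forms and representations* (1997), §3.6, (6.3)–(6.4), Thm. 3.6.1 and
  its proof, pp. 338–342 [Bump1997].
* J. Newton, J. A. Thorne, *Symmetric power functoriality for holomorphic modular forms, II*,
  Publ. Math. IHÉS 134 (2021), Thm. A [NewtonThorneIHES2021b].
-/

noncomputable section

open NumberField IsDedekindDomain MeasureTheory

namespace Literature.NumberTheory.Automorphic

open EllipticCurves.ModularForms

variable {N : ℕ} [NeZero N] {k : ℤ}

/-- **The adelisation statement holds** (Gelbart (1975), §3.A, (3.4), Prop. 3.1, p. 28 and
§3.B, Lemma 3.7; Bump (1997), §3.6, (6.3)–(6.4), proof of Thm. 3.6.1, pp. 341–342): discharge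
of the named fact `Gelbart1975_exists_adelicNewform` of `Sweep1SymmetricPowerAdelic`. The
witness is the `L²`-class of the adelic lift `φ_f = adelicLift N k f` (Bump's adelisation of
`f`), through `Gelbart1975_exists_adelicNewform_of_adelicLift` and the two proved analytic
statements `adelicLift_constantTermVanishes_holds` (cuspidality, Prop. 3.1 (vii)) and
`adelicLift_heckeEigenvalues_holds` (Hecke eigenvalues, Lemma 3.7).
[cite: Gelbart1975, Prop. 3.1, p. 28 and Lemma 3.7] [cite: Bump1997, §3.6, (6.3)–(6.4) and Thm. 3.6.1 (proof, pp. 341–342)] -/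
theorem Gelbart1975_exists_adelicNewform_holds : Gelbart1975_exists_adelicNewform (N := N) (k := k) :=
  Gelbart1975_exists_adelicNewform_of_adelicLift adelicLift_constantTermVanishes_holds
    adelicLift_heckeEigenvalues_holds

/-- **A cuspidal automorphic representation of a newform, for a given automorphic measure**
(Bump (1997), Thm. 3.6.1, proof, pp. 340–342; Gelbart (1975), §5.C, p. 62): if
`L²_cusp(GL₂(𝔸_ℚ) ⧸ A_G GL₂(ℚ), μ)` is discretely decomposable, every newform
`f ∈ S_k(Γ₁(N))`, `k ≥ 2`, has a cuspidal automorphic representation `P ≤ L²_cusp(μ)` with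
`IsAutomorphicRepOf f P` (`exists_isAutomorphicRepOf_of_adelicNewform` of
`Sweep1SymmetricPowerAdelic`, the adelisation statement being proved). [cite: Bump1997, Thm. 3.6.1 (proof, pp. 340–342)] -/
theorem exists_isAutomorphicRepOf_of_isDiscretelyDecomposable
    (μ : Measure (AdelicGroupData.gl 2 ℚ).automorphicQuotient)
    [(AdelicGroupData.gl 2 ℚ).IsAutomorphicMeasure μ] (hd : AutomorphicGLn.isDiscretelyDecomposable_cuspidal 2 ℚ μ)
    (hk : 2 ≤ k) {f : CuspForm (CongruenceSubgroup.Gamma1 N) k} (hf : IsNewform1 f) :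
    ∃ P : CuspidalAutomorphicRepGL 2 ℚ μ, IsAutomorphicRepOf f P.1 :=
  exists_isAutomorphicRepOf_of_adelicNewform Gelbart1975_exists_adelicNewform_holds μ hd hk hf

/-- **Gelbart's dictionary from the two trunk facts** (Gelbart (1975), Thm. 5.19 (a) in the
vendored form `Gelbart1975_exists_isAutomorphicRepOf` of `Sweep1SymmetricPower`; Bump (1997),
Thm. 3.6.1): the existence of an automorphic measure on `GL₂(𝔸_ℚ) ⧸ A_G GL₂(ℚ)`
(`exists_isAutomorphicMeasure_gl 2 ℚ`, Borel–Harish-Chandra) and the discrete decomposability of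
`L²_cusp` (`isDiscretelyDecomposable_cuspidal 2 ℚ μ`, Gelfand–Graev–Piatetski-Shapiro) imply
Gelbart's dictionary, the adelisation statement being proved. [cite: Bump1997, Thm. 3.6.1] -/
theorem Gelbart1975_exists_isAutomorphicRepOf_of_isDiscretelyDecomposable
    (hμ : AdelicGroupData.exists_isAutomorphicMeasure_gl 2 ℚ)
    (hd : ∀ (μ : Measure (AdelicGroupData.gl 2 ℚ).automorphicQuotient)
      [(AdelicGroupData.gl 2 ℚ).IsAutomorphicMeasure μ], AutomorphicGLn.isDiscretelyDecomposable_cuspidal 2 ℚ μ) :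
    Gelbart1975_exists_isAutomorphicRepOf (N := N) (k := k) :=
  Gelbart1975_exists_isAutomorphicRepOf_of_adelicNewform Gelbart1975_exists_adelicNewform_holds hμ hd

/-- **lang.S24 from the two trunk facts and Newton–Thorne's Thm. A**: the existence of an
automorphic measure, the discrete decomposability of `L²_cusp(GL₂(𝔸_ℚ) ⧸ A_G GL₂(ℚ))` and the
weak-lift form of Newton–Thorne's theorem (`NewtonThorne2021_exists_cuspidal_symmPowerLift`) imply
`exists_cuspidal_symmetricPower` (`exists_cuspidal_symmetricPower_of_adelicNewform`, the
adelisation statement being proved). [cite: NewtonThorneIHES2021b, Thm. A] -/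
theorem exists_cuspidal_symmetricPower_of_newtonThorne2021
    (hμ : AdelicGroupData.exists_isAutomorphicMeasure_gl 2 ℚ)
    (hd : ∀ (μ : Measure (AdelicGroupData.gl 2 ℚ).automorphicQuotient)
      [(AdelicGroupData.gl 2 ℚ).IsAutomorphicMeasure μ], AutomorphicGLn.isDiscretelyDecomposable_cuspidal 2 ℚ μ)
    (hNT : NewtonThorne2021_exists_cuspidal_symmPowerLift (N := N) (k := k)) :
    exists_cuspidal_symmetricPower (N := N) (k := k) :=
  exists_cuspidal_symmetricPower_of_adelicNewform Gelbart1975_exists_adelicNewform_holds hμ hd hNT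

/-- Under the two trunk facts, **lang.S24 is equivalent to the weak-lift form of Newton–Thorne's
Thm. A** (`exists_cuspidal_symmetricPower_iff_newtonThorne2021_of_adelicNewform`, the adelisation
statement being proved). [cite: NewtonThorneIHES2021b, Thm. A] -/
theorem exists_cuspidal_symmetricPower_iff_newtonThorne2021_of_isDiscretelyDecomposable
    (hμ : AdelicGroupData.exists_isAutomorphicMeasure_gl 2 ℚ)
    (hd : ∀ (μ : Measure (AdelicGroupData.gl 2 ℚ).automorphicQuotient)
      [(AdelicGroupData.gl 2 ℚ).IsAutomorphicMeasure μ], AutomorphicGLn.isDiscretelyDecomposable_cuspidal 2 ℚ μ) :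
    exists_cuspidal_symmetricPower (N := N) (k := k) ↔
      NewtonThorne2021_exists_cuspidal_symmPowerLift (N := N) (k := k) :=
  exists_cuspidal_symmetricPower_iff_newtonThorne2021_of_adelicNewform Gelbart1975_exists_adelicNewform_holds hμ hd

end Literature.NumberTheory.Automorphic
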